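import Summits.Ventures.PercRepro.RankLevelSetRuleQSliceUnimodal

/-!
# PercRepro — THE ARITHMETIC OF THE FIRST LEVEL: `(q+1)(q+2−m)·S_1(q,m) ≥ q+2` (night-1, gen 23)

The arithmetic half of the first-level theorem (`RankLevelSetHallLevelOne`): with `S_j(q,m) = sliceS q m j`,
`D(m) := (q+1)(q+2−m)·S_1(q,m) − (q+2)` satisfies `D(0) = 0` and `D(m+1) − D(m) = (q+1)·u(m)`,
`u(m) = (q+1−m)·S_2(q,m) − S_1(q,m)` (Pascal `sliceS_succ_m`).  The increments have the sign pattern `+ ⋯ + − ⋯ −`: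
`u(0) ≥ 0`, and once negative they stay negative because the ratio `(q+1−m)·S_2/S_1` is antitone in `m` — the tree's
`ratio_step` at `k = 2`.  Hence `D ≥ min(D(0), D(q))`, and `D(q) ≥ 0` from the exact value
`S_1(q,q) = 1/2 + J_2(q−1)` (`diag_odd`: `S_1(q, q−1) = 1/2`; `slice_two_succ_diag`: `J_2(q−1) = (4^q/C(2q,q))/(2(2q+1))`)
and `C(2q+1, q) ≤ 4^q` (`Nat.choose_middle_le_pow`).  Consequence (`level_one_demand`): `p/(q+1) ≤ (p−m)·S_1(q,m)` for
every `p ≥ q+2`, `m ≤ q` — Rule Q's first-level receipt pays the level demand `C(p+q,q+1)/C(p+q,q) = p/(q+1)`.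

* `levelOneInc`, `levelOneDef` — `u(m)`, `D(m)`; `levelOneDef_succ`, `levelOneDef_zero`, `levelOneInc_zero_nonneg`;
* `levelOneInc_neg_succ` — the propagation of a negative increment (`ratio_step`, `k = 2`);
* `sliceS_one_self`, `levelOneDef_self_nonneg` — `D(q) ≥ 0`;
* **`level_one_ineq`**, **`level_one_demand`**.
Axioms: standard.
-/

namespace PercRepro

open Set Matroid Finset

/-! ## The arithmetic inequality `(q+1)(q+2−m)·S_1(q,m) ≥ q+2` -/

/-- The increment function `u(m) = (q+1−m)·S_2(q,m) − S_1(q,m)`. -/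
noncomputable def levelOneInc (q m : ℕ) : ℚ := ((q : ℚ) + 1 - m) * sliceS q m 2 - sliceS q m 1

/-- The deficit function `D(m) = (q+1)(q+2−m)·S_1(q,m) − (q+2)`. -/
noncomputable def levelOneDef (q m : ℕ) : ℚ := ((q : ℚ) + 1) * ((q : ℚ) + 2 - m) * sliceS q m 1 - ((q : ℚ) + 2)

/-- `D(m+1) = D(m) + (q+1)·u(m)` (Pascal: `S_1(q, m+1) = S_1(q,m) + S_2(q,m)`). -/
lemma levelOneDef_succ (q m : ℕ) : levelOneDef q (m + 1) = levelOneDef q m + ((q : ℚ) + 1) * levelOneInc q m := by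
  unfold levelOneDef levelOneInc
  rw [sliceS_succ_m]
  push_cast
  ring

/-- `D(0) = 0`: `S_1(q, 0) = 1/(q+1)`. -/
lemma levelOneDef_zero (q : ℕ) : levelOneDef q 0 = 0 := by
  unfold levelOneDef sliceS
  simp only [Finset.range_one, Finset.sum_singleton, Nat.choose_self, Nat.cast_one, add_zero, zero_add]
  rw [Nat.choose_one_right]
  push_cast
  field_simp
  ring

/-- `u(0) ≥ 0`: `(q+1)/C(q+2,2) ≥ 1/(q+1)`. -/
lemma levelOneInc_zero_nonneg (q : ℕ) : 0 ≤ levelOneInc q 0 := by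
  unfold levelOneInc sliceS
  simp only [Finset.range_one, Finset.sum_singleton, Nat.choose_self, Nat.cast_one, add_zero, zero_add]
  rw [Nat.choose_one_right]
  -- C(q+2, 2) = (q+2)(q+1)/2
  have hc : ((q + 2).choose 2 : ℚ) = ((q : ℚ) + 2) * ((q : ℚ) + 1) / 2 := by
    have h := Nat.add_one_mul_choose_eq (q + 1) 1
    rw [Nat.choose_one_right] at h
    have h' : ((q + 1 + 1 : ℕ) : ℚ) * ((q + 1 : ℕ) : ℚ) = ((q + 1 + 1).choose (1 + 1) : ℚ) * ((1 + 1 : ℕ) : ℚ) := by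
      exact_mod_cast h
    push_cast at h'
    have e : (q + 1 + 1).choose (1 + 1) = (q + 2).choose 2 := rfl
    rw [e] at h'
    linarith
  rw [hc]
  push_cast
  have h1 : (0 : ℚ) < (q : ℚ) + 1 := by positivity
  have h2 : (0 : ℚ) < ((q : ℚ) + 2) * ((q : ℚ) + 1) / 2 := by positivity
  rw [sub_nonneg, mul_one_div, div_le_div_iff₀ h1 h2]
  nlinarith

/-- Once the increment is negative it stays negative (`ratio_step` at `k = 2`): for `1 ≤ m`, `m + 2 ≤ q`,
`u(m) < 0 → u(m+1) < 0`. -/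
lemma levelOneInc_neg_succ (q m : ℕ) (hm : 1 ≤ m) (hmq : m + 2 ≤ q) (h : levelOneInc q m < 0) :
    levelOneInc q (m + 1) < 0 := by
  have hr := ratio_step q 2 m (le_refl 2) hm hmq
  have e1 : (q - (m + 1) - 1 + 2).choose (2 - 1) = q - m := by
    rw [show 2 - 1 = 1 from rfl, Nat.choose_one_right]; omega
  have e2 : (q - m - 1 + 2).choose (2 - 1) = q - m + 1 := by
    rw [show 2 - 1 = 1 from rfl, Nat.choose_one_right]; omega
  rw [e1, e2] at hr
  have hc1 : ((q - m : ℕ) : ℚ) = (q : ℚ) - m := by rw [Nat.cast_sub (by omega)]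
  have hc2 : ((q - m + 1 : ℕ) : ℚ) = (q : ℚ) - m + 1 := by rw [Nat.cast_add, Nat.cast_sub (by omega)]; push_cast; ring
  rw [hc1, hc2] at hr
  unfold levelOneInc at h ⊢
  have hS1 := sliceS_pos q m 1
  have hS1' := sliceS_pos q (m + 1) 1
  have hS2' := sliceS_pos q (m + 1) 2
  -- (q−m+1)·S_2(m) < S_1(m)
  have hlt : ((q : ℚ) - m + 1) * sliceS q m 2 < sliceS q m 1 := by
    linarith
  -- (q−m)·S_2(m+1)·S_1(m) ≤ (q−m+1)·S_2(m)·S_1(m+1) < S_1(m)·S_1(m+1)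
  have h2 : ((q : ℚ) - m) * sliceS q (m + 1) 2 * sliceS q m 1 < sliceS q m 1 * sliceS q (m + 1) 1 := by
    calc ((q : ℚ) - m) * sliceS q (m + 1) 2 * sliceS q m 1
        ≤ ((q : ℚ) - m + 1) * sliceS q m 2 * sliceS q (m + 1) 1 := hr
      _ < sliceS q m 1 * sliceS q (m + 1) 1 := by
          have := mul_lt_mul_of_pos_right hlt hS1'
          linarith
  have h3 : ((q : ℚ) - m) * sliceS q (m + 1) 2 < sliceS q (m + 1) 1 := by
    by_contra hcon
    push Not at hcon
    have := mul_le_mul_of_nonneg_right hcon hS1.le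
    nlinarith
  push_cast
  linarith

/-- `S_1(q, q) = 1/2 + J_2(q−1)` with `J_2(q−1) = (4^q / C(2q, q)) / (2(2q+1))` (`diag_odd`, `slice_two_succ_diag`). -/
lemma sliceS_one_self (q : ℕ) (hq : 1 ≤ q) :
    sliceS q q 1 = 1 / 2 + ((4 : ℚ) ^ q / ((2 * q).choose q : ℚ)) / (2 * (2 * (q : ℚ) + 1)) := by
  obtain ⟨r, rfl⟩ : ∃ r, q = r + 1 := ⟨q - 1, by omega⟩
  rw [sliceS_succ_m]
  have h1 : sliceS (r + 1) r 1 = 1 / 2 := by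
    have := diag_odd 0 r
    simp only [mul_zero, zero_add, add_zero, Nat.choose_zero_right, Nat.cast_one, mul_one] at this
    exact this
  have h2 : sliceS (r + 1) r 2 = ((4 : ℚ) ^ (r + 1) / ((2 * r + 2).choose (r + 1) : ℚ)) / (2 * (2 * (r : ℚ) + 3)) :=
    slice_two_succ_diag r
  rw [h1, h2]
  push_cast
  ring_nf

/-- `D(q) ≥ 0`: `(q+1)·4^q ≥ (2q+1)·C(2q,q)`, from `C(2q+1, q) ≤ 4^q`. -/
lemma levelOneDef_self_nonneg (q : ℕ) : 0 ≤ levelOneDef q q := by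
  rcases Nat.eq_zero_or_pos q with rfl | hq
  · rw [levelOneDef_zero]
  unfold levelOneDef
  rw [sliceS_one_self q hq]
  -- the binomial bound
  have hb : (2 * q + 1) * (2 * q).choose q ≤ (q + 1) * 4 ^ q := by
    have h1 : (2 * q + 1) * (2 * q).choose q = (2 * q + 1).choose (q + 1) * (q + 1) :=
      Nat.add_one_mul_choose_eq (2 * q) q
    have h2 : (2 * q + 1).choose (q + 1) = (2 * q + 1).choose q := Nat.choose_symm_half q
    have h3 := Nat.choose_middle_le_pow q
    rw [h1, h2]
    nlinarith
  have hbq : ((2 * q + 1 : ℕ) : ℚ) * ((2 * q).choose q : ℚ) ≤ ((q + 1 : ℕ) : ℚ) * (4 : ℚ) ^ q := by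
    exact_mod_cast hb
  push_cast at hbq
  have hcpos : (0 : ℚ) < ((2 * q).choose q : ℚ) := by exact_mod_cast Nat.choose_pos (by omega)
  have hq' : (0 : ℚ) < (q : ℚ) := by exact_mod_cast hq
  have key : (1 : ℚ) ≤ ((q : ℚ) + 1) * ((4 : ℚ) ^ q / ((2 * q).choose q : ℚ)) / (2 * (q : ℚ) + 1) := by
    rw [le_div_iff₀ (by positivity), mul_div_assoc', le_div_iff₀ hcpos]
    linarith
  have e : ((q : ℚ) + 1) * ((q : ℚ) + 2 - q) = 2 * ((q : ℚ) + 1) := by ring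
  rw [e]
  have : 2 * ((q : ℚ) + 1) * (1 / 2 + ((4 : ℚ) ^ q / ((2 * q).choose q : ℚ)) / (2 * (2 * (q : ℚ) + 1)))
      = ((q : ℚ) + 1) + ((q : ℚ) + 1) * ((4 : ℚ) ^ q / ((2 * q).choose q : ℚ)) / (2 * (q : ℚ) + 1) := by
    field_simp
  rw [this]
  linarith

/-- The tail: from a negative increment at `1 ≤ j ≤ q` on, `D` decreases to `D(q)`: `D(q) ≤ D(j)`. -/
lemma levelOneDef_ge_self_of_inc_neg (q : ℕ) : ∀ d j : ℕ, j + d = q → 1 ≤ j → levelOneInc q j < 0 →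
    levelOneDef q q ≤ levelOneDef q j := by
  intro d
  induction d with
  | zero =>
    intro j hj _ _
    rw [add_zero] at hj
    rw [hj]
  | succ d ih =>
    intro j hj hj1 hneg
    have hstep : levelOneDef q (j + 1) = levelOneDef q j + ((q : ℚ) + 1) * levelOneInc q j := levelOneDef_succ q j
    have hq1 : (0 : ℚ) < (q : ℚ) + 1 := by positivity
    have hlt : levelOneDef q (j + 1) < levelOneDef q j := by
      rw [hstep]
      nlinarith
    rcases Nat.eq_zero_or_pos d with rfl | hd
    · -- j + 1 = q
      have hjq : j + 1 = q := by omega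
      have e : levelOneDef q q = levelOneDef q (j + 1) := by rw [hjq]
      rw [e]
      exact hlt.le
    · have hnext : levelOneInc q (j + 1) < 0 := levelOneInc_neg_succ q j hj1 (by omega) hneg
      have := ih (j + 1) (by omega) (by omega) hnext
      linarith

/-- **THE ARITHMETIC INEQUALITY OF THE FIRST LEVEL**: `(q+2) ≤ (q+1)(q+2−m)·S_1(q,m)` for `0 ≤ m ≤ q`. -/
theorem level_one_ineq (q : ℕ) : ∀ m : ℕ, m ≤ q →
    ((q : ℚ) + 2) ≤ ((q : ℚ) + 1) * ((q : ℚ) + 2 - m) * sliceS q m 1 := by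
  have key : ∀ m : ℕ, m ≤ q → 0 ≤ levelOneDef q m := by
    intro m
    induction m with
    | zero => intro _; rw [levelOneDef_zero]
    | succ m ih =>
      intro hmq
      have hD := ih (by omega)
      rw [levelOneDef_succ]
      have hq1 : (0 : ℚ) < (q : ℚ) + 1 := by positivity
      by_cases hu : 0 ≤ levelOneInc q m
      · nlinarith
      · push Not at hu
        -- m ≥ 1 since u(0) ≥ 0
        have hm1 : 1 ≤ m := by
          rcases Nat.eq_zero_or_pos m with rfl | h
          · exact absurd hu (not_lt.2 (levelOneInc_zero_nonneg q))
          · exact h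
        have hsucc : levelOneDef q m + ((q : ℚ) + 1) * levelOneInc q m = levelOneDef q (m + 1) :=
          (levelOneDef_succ q m).symm
        rw [hsucc]
        rcases Nat.lt_or_ge (m + 1) q with hlt | hge
        · have hnext : levelOneInc q (m + 1) < 0 := levelOneInc_neg_succ q m hm1 (by omega) hu
          have := levelOneDef_ge_self_of_inc_neg q (q - (m + 1)) (m + 1) (by omega) (by omega) hnext
          linarith [levelOneDef_self_nonneg q]
        · have hmq' : m + 1 = q := by omega
          rw [hmq']
          exact levelOneDef_self_nonneg q
  intro m hm
  have := key m hm
  unfold levelOneDef at this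
  linarith

/-- **Rule Q's first level pays the demand on every `p ≥ q + 2`**: `p/(q+1) ≤ (p − m)·S_1(q,m)` for `m ≤ q`. -/
theorem level_one_demand (p q m : ℕ) (hpq : q + 2 ≤ p) (hm : m ≤ q) :
    (p : ℚ) / ((q : ℚ) + 1) ≤ ((p : ℚ) - m) * sliceS q m 1 := by
  have h := level_one_ineq q m hm
  have hS := sliceS_pos q m 1
  have hq1 : (0 : ℚ) < (q : ℚ) + 1 := by positivity
  have hm' : (m : ℚ) ≤ q := by exact_mod_cast hm
  have hp' : (q : ℚ) + 2 ≤ p := by exact_mod_cast hpq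
  rw [div_le_iff₀ hq1]
  -- (q+1)(p−m)S_1 ≥ (q+1)(q+2−m)S_1 · (p−m)/(q+2−m) ≥ (q+2)(p−m)/(q+2−m) ≥ p
  have hq2m : (0 : ℚ) < (q : ℚ) + 2 - m := by linarith
  have h1 : ((q : ℚ) + 2) * ((p : ℚ) - m) ≤ ((q : ℚ) + 1) * ((q : ℚ) + 2 - m) * sliceS q m 1 * ((p : ℚ) - m) := by
    have hpm : (0 : ℚ) ≤ (p : ℚ) - m := by linarith
    exact mul_le_mul_of_nonneg_right h hpm
  have h2 : (p : ℚ) * ((q : ℚ) + 2 - m) ≤ ((q : ℚ) + 2) * ((p : ℚ) - m) := by nlinarith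
  have h3 : (p : ℚ) * ((q : ℚ) + 2 - m) ≤ ((q : ℚ) + 1) * ((q : ℚ) + 2 - m) * sliceS q m 1 * ((p : ℚ) - m) :=
    h2.trans h1
  have h3' : (p : ℚ) * ((q : ℚ) + 2 - m) ≤ (((q : ℚ) + 1) * sliceS q m 1 * ((p : ℚ) - m)) * ((q : ℚ) + 2 - m) := by
    calc (p : ℚ) * ((q : ℚ) + 2 - m)
        ≤ ((q : ℚ) + 1) * ((q : ℚ) + 2 - m) * sliceS q m 1 * ((p : ℚ) - m) := h3
      _ = (((q : ℚ) + 1) * sliceS q m 1 * ((p : ℚ) - m)) * ((q : ℚ) + 2 - m) := by ring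
  have h4 : (p : ℚ) ≤ ((q : ℚ) + 1) * sliceS q m 1 * ((p : ℚ) - m) := le_of_mul_le_mul_right h3' hq2m
  linarith [h4]

end PercRepro
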